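import Literature.Geometry.Lorentzian.DivergenceTheoremCompactSupport
import Literature.Geometry.Riemannian.GaussBonnetGradient
import Literature.Geometry.Lorentzian.DalembertianCompose
import Mathlib.Analysis.SpecialFunctions.SmoothTransition
import HarnessLib

/-!
# The divergence theorem on a regular sublevel domain `{σ < 0}`: fields tangent to the boundary

Topic `Geometry/Riemannian`; infrastructure for boundary-value problems on the smooth relatively
compact regular domains `D = {σ < 0}` of `RegularSublevelDomain.lean` (the domains of the Neumann
problem to which `Literature.Geometry.Riemannian.sharpLogSobolevAVR_four` is reduced in
`SharpLogSobolevAVRNeumann.lean`). On a Riemannian manifold `(N, g)` without boundary (modelled on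
`ℝᵐ`, Hausdorff, locally compact, σ-compact; NOT necessarily compact) let `σ ∈ C^∞(N)` with
`{σ ≤ 0}` compact and `|∇σ|² > 0` on `{σ = 0}`, and let `Y` be a `C¹` vector field. We PROVE the
divergence theorem on `D` in the form that needs no surface measure:

* `setIntegral_vectorDivergence_sublevel_eq_zero` — **if `Y` is tangent to `∂D`**, i.e.
  `dσ(Y) = g(∇σ, Y) = 0` on `{σ = 0}`, **then `∫_D div Y dμ_g = 0`** (Lee 2018, Thm. 2.28 /
  Problem 2-22 with vanishing boundary term `∫_{∂D} ⟨Y, ν⟩ = 0`);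
* `setIntegral_vectorDivergence_sublevel_congr` — consequently **`∫_D div Y dμ_g` depends only
  on the normal component `g(∇σ, Y)` on `∂D`**: two `C¹` fields with the same `dσ(·)` on
  `{σ = 0}` have the same integral of the divergence over `D` (so boundary fluxes can be computed
  from any convenient extension of the boundary data, e.g. to define `|∂D| = ∫_D div X` for an
  extension `X` of the outer unit normal).

Method (a collar cut-off argument, O'Neill 1983 Ch. 7 / Lee 2018 Thm. 2.28 for closed
manifolds made relative): with the antitone profile `ψ_ε(t) = smoothTransition(-t/ε - 1)`
(`= 1` for `t ≤ -2ε`, `= 0` for `t ≥ -ε`) and the compactly supported cut-off `χ_ε = ψ_ε ∘ σ`,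
the compact-support divergence theorem (`DivergenceTheoremCompactSupport.lean`) gives
`∫ χ_ε div Y = -∫ ψ_ε'(σ) dσ(Y)` (`integral_cutoff_mul_vectorDivergence_eq`). As `ε → 0` the
left side tends to `∫_D div Y` (the collar `{-2ε < σ < 0}` has measure `→ 0` by continuity of the
measure), while the right side is small: `|dσ(Y)| < η` on a collar (compactness,
`exists_collar_forall`) and the total mass `∫ (-ψ_ε'(σ)) dμ` stays bounded because, by Green's
identity for the compactly supported `χ_ε`, `∫ (-ψ_ε'(σ)) |∇σ|² dμ = ∫ χ_ε Δσ dμ ≤ ∫_{σ≤0} |Δσ|`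
(`integral_neg_deriv_cutoff_mul_gradSq_le`) and `|∇σ|² ≥ n₀ > 0` on a collar.

Also: the profile lemmas `smoothTransition_collar_eq_one/zero`, `…_antitone`,
`deriv_smoothTransition_collar_nonpos/eq_zero`, the cut-off lemmas `contMDiff_collar_cutoff`,
`hasCompactSupport_collar_cutoff`, `mvfderiv_collar_cutoff`, and `vectorDivergence_sub`,
`continuous_vectorDivergence_of_isRiemannian`, `continuous_val_grad_apply_section`.
Pure proofs; no definitions, no named facts.

## References

* J. M. Lee, *Introduction to Riemannian Manifolds*, 2nd ed., GTM 176 (2018), Thm. 2.28 and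
  Problem 2-22 (divergence theorem with boundary term). [Lee2018]
* B. O'Neill, *Semi-Riemannian Geometry* (1983), Ch. 7, Lemma 21 / Ex. (divergence theorem).
  [ONeill1983]
-/

noncomputable section

open Bundle Set Function Filter MeasureTheory Manifold
open scoped Manifold ContDiff Topology

namespace Literature.Geometry.Riemannian

open Lorentzian Lorentzian.PseudoRiemannianMetric

/-! ### The collar cut-off profile `ψ_ε(t) = smoothTransition(-t/ε - 1)` -/

section Profile

/-- The collar profile `ψ_ε(t) = smoothTransition(-t/ε - 1)` equals `1` for `t ≤ -2ε`. [folklore] -/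
theorem smoothTransition_collar_eq_one {ε t : ℝ} (hε : 0 < ε) (ht : t ≤ -(2 * ε)) :
    Real.smoothTransition (-t / ε - 1) = 1 := by
  apply Real.smoothTransition.one_of_one_le
  rw [le_sub_iff_add_le, le_div_iff₀ hε]
  linarith

/-- The collar profile vanishes for `t ≥ -ε`. [folklore] -/
theorem smoothTransition_collar_eq_zero {ε t : ℝ} (hε : 0 < ε) (ht : -ε ≤ t) :
    Real.smoothTransition (-t / ε - 1) = 0 := by
  apply Real.smoothTransition.zero_of_nonpos
  rw [sub_nonpos, div_le_iff₀ hε]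
  linarith

/-- The collar profile is antitone (`smoothTransition` is monotone). [folklore] -/
theorem smoothTransition_collar_antitone {ε : ℝ} (hε : 0 < ε) :
    Antitone fun t : ℝ ↦ Real.smoothTransition (-t / ε - 1) := by
  intro a b hab
  apply Real.smoothTransition.monotone
  have : -b / ε ≤ -a / ε := div_le_div_of_nonneg_right (by linarith) hε.le
  linarith

/-- The collar profile is smooth. [folklore] -/
theorem contDiff_smoothTransition_collar (ε : ℝ) :
    ContDiff ℝ ∞ fun t : ℝ ↦ Real.smoothTransition (-t / ε - 1) :=
  Real.smoothTransition.contDiff.comp (((contDiff_neg.div_const ε).sub contDiff_const))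

/-- The derivative of the collar profile is nonpositive. [folklore] -/
theorem deriv_smoothTransition_collar_nonpos {ε : ℝ} (hε : 0 < ε) (t : ℝ) :
    deriv (fun t : ℝ ↦ Real.smoothTransition (-t / ε - 1)) t ≤ 0 :=
  (smoothTransition_collar_antitone hε).deriv_nonpos

/-- The derivative of the collar profile vanishes off `[-2ε, -ε]`. [folklore] -/
theorem deriv_smoothTransition_collar_eq_zero {ε t : ℝ} (hε : 0 < ε)
    (ht : t < -(2 * ε) ∨ -ε < t) :
    deriv (fun t : ℝ ↦ Real.smoothTransition (-t / ε - 1)) t = 0 := by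
  rcases ht with ht | ht
  · -- locally constant `= 1`
    have hev : ∀ᶠ s in 𝓝 t, Real.smoothTransition (-s / ε - 1) = (fun _ ↦ (1 : ℝ)) s := by
      filter_upwards [Iio_mem_nhds ht] with s hs
      exact smoothTransition_collar_eq_one hε (le_of_lt hs)
    rw [Filter.EventuallyEq.deriv_eq hev, deriv_const]
  · have hev : ∀ᶠ s in 𝓝 t, Real.smoothTransition (-s / ε - 1) = (fun _ ↦ (0 : ℝ)) s := by
      filter_upwards [Ioi_mem_nhds ht] with s hs
      exact smoothTransition_collar_eq_zero hε (le_of_lt hs)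
    rw [Filter.EventuallyEq.deriv_eq hev, deriv_const]

end Profile

/-! ### Collars of a regular sublevel domain -/

section Collar

variable {N : Type*} [TopologicalSpace N]

/-- **Collar lemma**: if `{σ ≤ 0}` is compact and an open set `U` contains `{σ = 0}`, then `U`
contains a collar `{-δ < σ ≤ 0}` (the compact set `{σ ≤ 0} ∖ U` lies in `{σ < 0}`, where the
continuous `σ` attains a negative maximum). [folklore] -/
theorem exists_collar_forall {σ : N → ℝ} (hσ : Continuous σ) (hK : IsCompact {x | σ x ≤ 0})
    {U : Set N} (hU : IsOpen U) (h0 : ∀ x, σ x = 0 → x ∈ U) :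
    ∃ δ > 0, ∀ x, -δ < σ x → σ x ≤ 0 → x ∈ U := by
  set S : Set N := {x | σ x ≤ 0} ∩ Uᶜ with hS
  have hSc : IsCompact S := hK.inter_right hU.isClosed_compl
  rcases S.eq_empty_or_nonempty with hSe | hSne
  · refine ⟨1, one_pos, fun x _ hx0 ↦ ?_⟩
    by_contra hxU
    have : x ∈ S := ⟨hx0, hxU⟩
    rw [hSe] at this
    exact this
  · obtain ⟨z, hzS, hzmax⟩ := hSc.exists_isMaxOn hSne hσ.continuousOn
    have hz0 : σ z < 0 := by
      rcases (show σ z ≤ 0 from hzS.1).lt_or_eq with h | h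
      · exact h
      · exact absurd (h0 z h) hzS.2
    refine ⟨-σ z, by linarith, fun x hx hx0 ↦ ?_⟩
    by_contra hxU
    have h1 : σ x ≤ σ z := hzmax (show x ∈ S from ⟨hx0, hxU⟩)
    linarith

end Collar

/-! ### The cut-off `χ_ε = ψ_ε ∘ σ` on a Riemannian manifold: Green and divergence identities -/

section Riemannian

variable {m : ℕ} {H : Type*} [TopologicalSpace H]
  {I : ModelWithCorners ℝ (EuclideanSpace ℝ (Fin m)) H} [I.Boundaryless]
  {N : Type*} [TopologicalSpace N] [ChartedSpace H N] [IsManifold I ∞ N]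
  [T2Space N] [LocallyCompactSpace N] [SigmaCompactSpace N] [MeasurableSpace N] [BorelSpace N]
  (g : PseudoRiemannianMetric I ∞ (EuclideanSpace ℝ (Fin m)) (TangentSpace I : N → Type _))
  [g.HasLeviCivita]

omit [I.Boundaryless] [IsManifold I ∞ N] [T2Space N] [LocallyCompactSpace N] [SigmaCompactSpace N]
  [MeasurableSpace N] [BorelSpace N] in
/-- The cut-off `χ_ε = ψ_ε ∘ σ` is smooth for smooth `σ`. [folklore] -/
theorem contMDiff_collar_cutoff {σ : N → ℝ} (hσ : CMDiff ∞ σ) (ε : ℝ) :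
    CMDiff ∞ fun x ↦ Real.smoothTransition (-σ x / ε - 1) :=
  (contDiff_smoothTransition_collar ε).comp_contMDiff hσ

omit [I.Boundaryless] [IsManifold I ∞ N] [LocallyCompactSpace N] [SigmaCompactSpace N]
  [MeasurableSpace N] [BorelSpace N] in
/-- The cut-off `χ_ε` has compact support (inside `{σ ≤ 0}`). [folklore] -/
theorem hasCompactSupport_collar_cutoff {σ : N → ℝ} (hK : IsCompact {x | σ x ≤ 0}) {ε : ℝ}
    (hε : 0 < ε) : HasCompactSupport fun x ↦ Real.smoothTransition (-σ x / ε - 1) := by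
  refine HasCompactSupport.of_support_subset_isCompact hK fun x hx ↦ ?_
  by_contra hx0
  have hx0' : 0 < σ x := not_le.1 hx0
  exact hx (smoothTransition_collar_eq_zero hε (by linarith))

omit [I.Boundaryless] [IsManifold I ∞ N] [T2Space N] [LocallyCompactSpace N] [SigmaCompactSpace N]
  [MeasurableSpace N] [BorelSpace N] in
/-- `dχ_ε = ψ_ε'(σ) dσ` (chain rule). [folklore] -/
theorem mvfderiv_collar_cutoff {σ : N → ℝ} (hσ : CMDiff ∞ σ) (ε : ℝ) (x : N)
    (v : TangentSpace I x) :
    mvfderiv I (fun x ↦ Real.smoothTransition (-σ x / ε - 1)) x v =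
      deriv (fun t : ℝ ↦ Real.smoothTransition (-t / ε - 1)) (σ x) * mvfderiv I σ x v :=
  mvfderiv_real_comp ((contDiff_smoothTransition_collar ε).contDiffAt.differentiableAt (by simp))
    ((hσ x).mdifferentiableAt (by simp)) v

/-- **Green bound for the collar mass**: `∫ (-ψ_ε'(σ)) |∇σ|²_g dμ_g = ∫ χ_ε Δ_g σ dμ_g ≤
∫_{σ ≤ 0} |Δ_g σ| dμ_g` (Green's first identity for the compactly supported `χ_ε`,
`integral_mul_dalembertian_eq_neg_integral_innerDual_of_hasCompactSupport`, and `0 ≤ χ_ε ≤ 1`).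
[cite: Lee2018, Problem 2-23 (a)] -/
theorem integral_neg_deriv_cutoff_mul_gradSq_le (hg : g.IsRiemannian) {σ : N → ℝ}
    (hσ : CMDiff ∞ σ) (hK : IsCompact {x | σ x ≤ 0}) {ε : ℝ} (hε : 0 < ε) :
    ∫ x, -deriv (fun t : ℝ ↦ Real.smoothTransition (-t / ε - 1)) (σ x) * g.gradSq σ x
        ∂(riemannianMeasure (g.toContMDiffRiemannianMetric hg)) ≤
      ∫ x in {x | σ x ≤ 0}, |g.dalembertian σ x|
        ∂(riemannianMeasure (g.toContMDiffRiemannianMetric hg)) := by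
  set h := g.toContMDiffRiemannianMetric hg with hh_def
  set μ : Measure N := riemannianMeasure h with hμ
  haveI : IsFiniteMeasureOnCompacts μ :=
    ⟨fun K hK ↦ riemannianVolume_lt_top_of_isCompact_holds _ le_rfl hK⟩
  haveI : (ofRiemannian h).HasLeviCivita := ‹g.HasLeviCivita›
  set ψ : ℝ → ℝ := fun t ↦ Real.smoothTransition (-t / ε - 1) with hψ
  set χ : N → ℝ := fun x ↦ Real.smoothTransition (-σ x / ε - 1) with hχ
  have hχs : CMDiff ∞ χ := contMDiff_collar_cutoff hσ ε
  have hχc : HasCompactSupport χ := hasCompactSupport_collar_cutoff hK hε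
  -- Green's first identity for `χ` and `σ`
  have h2 : (2 : ℕ∞ω) ≤ ((⊤ : ℕ∞) : ℕ∞ω) := WithTop.coe_le_coe.2 le_top
  have hG := integral_mul_dalembertian_eq_neg_integral_innerDual_of_hasCompactSupport h
    (hχs.of_le (by exact_mod_cast le_top)) hχc (hσ.of_le h2)
  -- the integrand of the right-hand side is `ψ'(σ) |∇σ|²`
  have hinner : ∀ p : N, (ofRiemannian h).innerDual p (mvfderiv I χ p).toLinearMap
      (mvfderiv I σ p).toLinearMap = deriv ψ (σ p) * g.gradSq σ p := by
    intro p
    show (mvfderiv I χ p) (g.sharp p (mvfderiv I σ p).toLinearMap) = _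
    rw [mvfderiv_collar_cutoff hσ ε p]
    rfl
  simp_rw [hinner] at hG
  have hG' : ∫ x, -deriv ψ (σ x) * g.gradSq σ x ∂μ = ∫ x, χ x * g.dalembertian σ x ∂μ := by
    simp_rw [neg_mul, integral_neg]
    exact hG.symm
  rw [hG']
  -- `|χ Δσ| ≤ |Δσ| 1_{σ ≤ 0}`
  have hΔc : Continuous (g.dalembertian σ) := continuous_dalembertian g (hσ.of_le h2)
  have hχ01 : ∀ x, 0 ≤ χ x ∧ χ x ≤ 1 := fun x ↦
    ⟨Real.smoothTransition.nonneg _, Real.smoothTransition.le_one _⟩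
  have hχ0 : ∀ x, ¬ σ x ≤ 0 → χ x = 0 := fun x hx ↦
    smoothTransition_collar_eq_zero hε (by have := not_le.1 hx; linarith)
  calc ∫ x, χ x * g.dalembertian σ x ∂μ
      = ∫ x in {x | σ x ≤ 0}, χ x * g.dalembertian σ x ∂μ := by
        refine (setIntegral_eq_integral_of_forall_compl_eq_zero fun x hx ↦ ?_).symm
        rw [hχ0 x hx, zero_mul]
    _ ≤ ∫ x in {x | σ x ≤ 0}, |g.dalembertian σ x| ∂μ := by
        refine setIntegral_mono_on ?_ ?_ (isClosed_le hσ.continuous continuous_const).measurableSet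
          fun x _ ↦ ?_
        · exact ((hχs.continuous.mul hΔc).continuousOn.integrableOn_compact hK)
        · exact (continuous_abs.comp hΔc).continuousOn.integrableOn_compact hK
        · calc χ x * g.dalembertian σ x ≤ |χ x * g.dalembertian σ x| := le_abs_self _
            _ = χ x * |g.dalembertian σ x| := by
                rw [abs_mul, abs_of_nonneg (hχ01 x).1]
            _ ≤ 1 * |g.dalembertian σ x| :=
                mul_le_mul_of_nonneg_right (hχ01 x).2 (abs_nonneg _)
            _ = |g.dalembertian σ x| := one_mul _

/-- **The cut-off divergence identity** `∫ χ_ε div Y dμ_g = -∫ ψ_ε'(σ) dσ(Y) dμ_g` for a `C¹`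
field `Y` (the compact-support integration by parts
`integral_mul_vectorDivergence_eq_neg_integral_mvfderiv_of_hasCompactSupport` with `u = χ_ε`).
[cite: Lee2018, Problem 2-22 (a)] -/
theorem integral_cutoff_mul_vectorDivergence_eq (hg : g.IsRiemannian) {σ : N → ℝ}
    (hσ : CMDiff ∞ σ) (hK : IsCompact {x | σ x ≤ 0}) {ε : ℝ} (hε : 0 < ε)
    {Y : Π x : N, TangentSpace I x} (hY : CMDiff 1 (T% Y)) :
    ∫ x, Real.smoothTransition (-σ x / ε - 1) * g.vectorDivergence Y x
        ∂(riemannianMeasure (g.toContMDiffRiemannianMetric hg)) =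
      -∫ x, deriv (fun t : ℝ ↦ Real.smoothTransition (-t / ε - 1)) (σ x) * mvfderiv I σ x (Y x)
        ∂(riemannianMeasure (g.toContMDiffRiemannianMetric hg)) := by
  set h := g.toContMDiffRiemannianMetric hg with hh_def
  haveI : (ofRiemannian h).HasLeviCivita := ‹g.HasLeviCivita›
  have hχs : CMDiff ∞ (fun x ↦ Real.smoothTransition (-σ x / ε - 1)) :=
    contMDiff_collar_cutoff hσ ε
  have h1 := integral_mul_vectorDivergence_eq_neg_integral_mvfderiv_of_hasCompactSupport h
    (hχs.of_le (by exact_mod_cast le_top)) (hasCompactSupport_collar_cutoff hK hε) hY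
  have h1' : ∫ x, Real.smoothTransition (-σ x / ε - 1) * g.vectorDivergence Y x
      ∂(riemannianMeasure h) =
      -∫ x, mvfderiv I (fun x ↦ Real.smoothTransition (-σ x / ε - 1)) x (Y x)
        ∂(riemannianMeasure h) := h1
  rw [h1']
  congr 1
  refine integral_congr_ae (Eventually.of_forall fun x ↦ ?_)
  exact mvfderiv_collar_cutoff hσ ε x (Y x)

omit [MeasurableSpace N] [BorelSpace N] in
/-- The divergence of a `C¹` field is continuous (the tree's `continuous_vectorDivergence`,
restated for a Riemannian `PseudoRiemannianMetric`). [folklore] -/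
theorem continuous_vectorDivergence_of_isRiemannian (hg : g.IsRiemannian)
    {Y : Π x : N, TangentSpace I x}
    (hY : CMDiff 1 (T% Y)) : Continuous (g.vectorDivergence Y) := by
  haveI : (ofRiemannian (g.toContMDiffRiemannianMetric hg)).HasLeviCivita := ‹g.HasLeviCivita›
  exact continuous_vectorDivergence (g.toContMDiffRiemannianMetric hg) hY

omit [T2Space N] [LocallyCompactSpace N] [SigmaCompactSpace N] [MeasurableSpace N]
  [BorelSpace N] in
omit [g.HasLeviCivita] in
/-- The flux density `x ↦ g(∇σ, Y)` of a `C¹` field against a smooth `σ` is continuous.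
[folklore] -/
theorem continuous_val_grad_apply_section {σ : N → ℝ} (hσ : CMDiff ∞ σ)
    {Y : Π x : N, TangentSpace I x} (hY : CMDiff 1 (T% Y)) :
    Continuous fun x ↦ g.val x (grad g σ x) (Y x) := by
  have h1le : (1 : ℕ∞ω) ≤ ∞ := by exact_mod_cast le_top
  have hgr : CMDiff 1 (T% (grad g σ)) := (contMDiff_grad g hσ).of_le h1le
  exact (show CMDiff 1 (fun x ↦ g.val x (grad g σ x) (Y x)) from
    fun x ↦ contMDiffAt_val_apply g h1le (hgr x) (hY x)).continuous

set_option maxHeartbeats 1600000 in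
/-- **The divergence theorem on a regular sublevel domain, for fields tangent to the boundary**
(Lee 2018, Thm. 2.28 / Problem 2-22 with `∫_{∂D} ⟨Y, ν⟩ = 0`). On a Riemannian manifold without
boundary let `σ` be smooth with `{σ ≤ 0}` compact and `|∇σ|² > 0` on `{σ = 0}`, and let `Y` be
a `C¹` vector field with `dσ(Y) = 0` on `{σ = 0}`. Then `∫_{σ<0} div Y dμ_g = 0`. Proof: the
collar cut-off argument of the module docstring. [cite: Lee2018, Thm. 2.28] -/
theorem setIntegral_vectorDivergence_sublevel_eq_zero (hg : g.IsRiemannian) {σ : N → ℝ}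
    (hσ : CMDiff ∞ σ) (hK : IsCompact {x | σ x ≤ 0}) (hreg : ∀ x, σ x = 0 → 0 < g.gradSq σ x)
    {Y : Π x : N, TangentSpace I x} (hY : CMDiff 1 (T% Y))
    (hYσ : ∀ x, σ x = 0 → mvfderiv I σ x (Y x) = 0) :
    ∫ x in {x | σ x < 0}, g.vectorDivergence Y x
      ∂(riemannianMeasure (g.toContMDiffRiemannianMetric hg)) = 0 := by
  set h := g.toContMDiffRiemannianMetric hg with hh_def
  set μ : Measure N := riemannianMeasure h with hμ
  haveI : IsFiniteMeasureOnCompacts μ :=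
    ⟨fun K hK ↦ riemannianVolume_lt_top_of_isCompact_holds _ le_rfl hK⟩
  set ψ : ℝ → ℝ → ℝ := fun ε t ↦ Real.smoothTransition (-t / ε - 1) with hψ
  set F : N → ℝ := fun x ↦ mvfderiv I σ x (Y x) with hF
  have hFeq : F = fun x ↦ g.val x (grad g σ x) (Y x) := funext fun x ↦ (val_grad g σ x _).symm
  have hFc : Continuous F := hFeq ▸ continuous_val_grad_apply_section g hσ hY
  have hdivc : Continuous (g.vectorDivergence Y) :=
    continuous_vectorDivergence_of_isRiemannian g hg hY
  have h1le : (1 : ℕ∞ω) ≤ ∞ := by exact_mod_cast le_top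
  have hgradc : Continuous (g.gradSq σ) := by
    have h1 : g.gradSq σ = fun x ↦ g.val x (grad g σ x) (grad g σ x) :=
      funext fun x ↦ by rw [val_grad]; rfl
    rw [h1]
    exact continuous_val_grad_apply_section g hσ ((contMDiff_grad g hσ).of_le h1le)
  have hσc : Continuous σ := hσ.continuous
  have hKm : MeasurableSet {x | σ x ≤ 0} := (isClosed_le hσc continuous_const).measurableSet
  have hDm : MeasurableSet {x | σ x < 0} := (isOpen_lt hσc continuous_const).measurableSet
  have hDK : {x | σ x < 0} ⊆ {x | σ x ≤ 0} := fun x (hx : σ x < 0) ↦ hx.le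
  have hKfin : μ {x | σ x ≤ 0} < ⊤ := hK.measure_lt_top
  -- a positive lower bound `n₀` for `|∇σ|²` on a collar `{-δ₁ < σ ≤ 0}`
  obtain ⟨n₀, hn₀, hn₀Z⟩ : ∃ n₀ : ℝ, 0 < n₀ ∧ ∀ x, σ x = 0 → n₀ < g.gradSq σ x := by
    set Z : Set N := {x | σ x ≤ 0} ∩ {x | 0 ≤ σ x} with hZ
    have hZc : IsCompact Z := hK.inter_right (isClosed_le continuous_const hσc)
    rcases Z.eq_empty_or_nonempty with hZe | hZne
    · refine ⟨1, one_pos, fun x hx ↦ ?_⟩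
      have : x ∈ Z := ⟨hx.le, hx.ge⟩
      rw [hZe] at this
      exact absurd this (notMem_empty x)
    · obtain ⟨z, hzZ, hzmin⟩ := hZc.exists_isMinOn hZne hgradc.continuousOn
      have hz0 : σ z = 0 := le_antisymm hzZ.1 hzZ.2
      refine ⟨g.gradSq σ z / 2, by linarith [hreg z hz0], fun x hx ↦ ?_⟩
      have h1 : g.gradSq σ z ≤ g.gradSq σ x := hzmin (show x ∈ Z from ⟨hx.le, hx.ge⟩)
      linarith [hreg z hz0]
  obtain ⟨δ₁, hδ₁, hcol₁⟩ := exists_collar_forall hσc hK (isOpen_lt continuous_const hgradc) hn₀Z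
  -- the Green constant `C₁` and a bound `M` for `|div Y|` on `{σ ≤ 0}`
  set C₁ : ℝ := ∫ x in {x | σ x ≤ 0}, |g.dalembertian σ x| ∂μ with hC₁
  have hC₁0 : 0 ≤ C₁ := setIntegral_nonneg hKm fun x _ ↦ abs_nonneg _
  obtain ⟨M, hM0, hM⟩ : ∃ M : ℝ, 0 ≤ M ∧ ∀ x, σ x ≤ 0 → |g.vectorDivergence Y x| ≤ M := by
    obtain ⟨B, hB⟩ := hK.exists_bound_of_continuousOn hdivc.continuousOn
    exact ⟨max B 0, le_max_right _ _, fun x hx ↦ (hB x hx).trans (le_max_left _ _)⟩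
  -- it suffices to bound `|A|` by every `η > 0`
  set A : ℝ := ∫ x in {x | σ x < 0}, g.vectorDivergence Y x ∂μ with hA
  suffices hmain : ∀ η : ℝ, 0 < η → |A| ≤ η by
    have h0 : |A| ≤ 0 := le_of_forall_pos_le_add fun η hη ↦ by simpa using hmain η hη
    exact abs_nonpos_iff.1 h0
  intro η hη
  -- (a) the flux density is `< η'` on a collar `{-δ₂ < σ ≤ 0}`
  set η' : ℝ := η / (2 * (C₁ / n₀ + 1)) with hη'
  have hη'0 : 0 < η' := by positivity
  obtain ⟨δ₂, hδ₂, hcol₂⟩ := exists_collar_forall hσc hK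
    (isOpen_lt (continuous_abs.comp hFc) continuous_const) (U := {x | |F x| < η'})
    (fun x hx ↦ by show |F x| < η'; rw [hF]; simp only [hYσ x hx, abs_zero]; exact hη'0)
  -- (b) a thin collar `S = {-(1/(k+1)) < σ < 0}` of small measure
  set S : ℕ → Set N := fun k ↦ {x | -(1 / ((k : ℝ) + 1)) < σ x ∧ σ x < 0} with hS
  have hSm : ∀ k, MeasurableSet (S k) := fun k ↦
    ((isOpen_lt continuous_const hσc).inter (isOpen_lt hσc continuous_const)).measurableSet
  have hSanti : Antitone S := by
    intro k l hkl x hx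
    refine ⟨lt_of_le_of_lt ?_ hx.1, hx.2⟩
    have : (1 : ℝ) / ((l : ℝ) + 1) ≤ 1 / ((k : ℝ) + 1) :=
      one_div_le_one_div_of_le (by positivity) (by exact_mod_cast Nat.succ_le_succ hkl)
    linarith
  have hSK : ∀ k, S k ⊆ {x | σ x ≤ 0} := fun k x hx ↦ hx.2.le
  have hSlim : Tendsto (μ ∘ S) atTop (𝓝 0) := by
    have h1 := tendsto_measure_iInter_atTop (μ := μ) (fun k ↦ (hSm k).nullMeasurableSet) hSanti
      ⟨0, (lt_of_le_of_lt (measure_mono (hSK 0)) hKfin).ne⟩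
    have h2 : ⋂ k, S k = ∅ := by
      refine eq_empty_of_forall_notMem fun x hx ↦ ?_
      rw [mem_iInter] at hx
      have hx0 : σ x < 0 := (hx 0).2
      obtain ⟨k, hk⟩ := exists_nat_gt (1 / (-σ x))
      have h3 := (hx k).1
      have h4 : 1 / ((k : ℝ) + 1) < -σ x := by
        rw [div_lt_iff₀ (by positivity)]
        have h5 : 1 / (-σ x) * (-σ x) = 1 := div_mul_cancel₀ 1 (by linarith)
        nlinarith
      linarith
    rwa [h2, measure_empty] at h1
  obtain ⟨k, hk⟩ : ∃ k : ℕ, μ (S k) < ENNReal.ofReal (η / (2 * (M + 1))) := by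
    have hpos : (0 : ENNReal) < ENNReal.ofReal (η / (2 * (M + 1))) :=
      ENNReal.ofReal_pos.2 (by positivity)
    exact (hSlim.eventually (Iio_mem_nhds hpos)).exists
  have hk' : (μ (S k)).toReal ≤ η / (2 * (M + 1)) :=
    ENNReal.toReal_le_of_le_ofReal (by positivity) hk.le
  -- (c) the cut-off scale `ε`
  set ε : ℝ := min (min δ₁ δ₂) (1 / ((k : ℝ) + 1)) / 4 with hε_def
  have hmin0 : 0 < min (min δ₁ δ₂) (1 / ((k : ℝ) + 1)) := lt_min (lt_min hδ₁ hδ₂) (by positivity)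
  have hε : 0 < ε := by rw [hε_def]; linarith
  have h2ε₁ : 2 * ε < δ₁ := by
    have : min (min δ₁ δ₂) (1 / ((k : ℝ) + 1)) ≤ δ₁ := (min_le_left _ _).trans (min_le_left _ _)
    rw [hε_def]; linarith
  have h2ε₂ : 2 * ε < δ₂ := by
    have : min (min δ₁ δ₂) (1 / ((k : ℝ) + 1)) ≤ δ₂ := (min_le_left _ _).trans (min_le_right _ _)
    rw [hε_def]; linarith
  have h2εk : 2 * ε < 1 / ((k : ℝ) + 1) := by
    have : min (min δ₁ δ₂) (1 / ((k : ℝ) + 1)) ≤ 1 / ((k : ℝ) + 1) := min_le_right _ _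
    rw [hε_def]; linarith
  set χ : N → ℝ := fun x ↦ Real.smoothTransition (-σ x / ε - 1) with hχ
  have hχs : CMDiff ∞ χ := contMDiff_collar_cutoff hσ ε
  have hχcont : Continuous χ := hχs.continuous
  have hχ01 : ∀ x, 0 ≤ χ x ∧ χ x ≤ 1 := fun x ↦
    ⟨Real.smoothTransition.nonneg _, Real.smoothTransition.le_one _⟩
  have hχ1 : ∀ x, σ x ≤ -(2 * ε) → χ x = 1 := fun x hx ↦ smoothTransition_collar_eq_one hε hx
  have hχ0 : ∀ x, -ε ≤ σ x → χ x = 0 := fun x hx ↦ smoothTransition_collar_eq_zero hε hx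
  set ψ' : ℝ → ℝ := deriv fun t : ℝ ↦ Real.smoothTransition (-t / ε - 1) with hψ'
  have hψ'c : Continuous ψ' := (contDiff_smoothTransition_collar ε).continuous_deriv (by simp)
  have hψ'0 : ∀ x, ψ' (σ x) ≤ 0 := fun x ↦ deriv_smoothTransition_collar_nonpos hε _
  have hψ'supp : ∀ x, ψ' (σ x) ≠ 0 → -(2 * ε) ≤ σ x ∧ σ x ≤ -ε := fun x hx ↦ by
    by_contra hcon
    apply hx
    apply deriv_smoothTransition_collar_eq_zero hε
    rcases not_and_or.1 hcon with h1 | h1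
    · exact Or.inl (not_le.1 h1)
    · exact Or.inr (not_le.1 h1)
  -- integrability facts
  have hint : ∀ w : N → ℝ, Continuous w → IntegrableOn w {x | σ x ≤ 0} μ := fun w hw ↦
    hw.continuousOn.integrableOn_compact hK
  have hχdi : Integrable (fun x ↦ χ x * g.vectorDivergence Y x) μ := by
    refine (integrableOn_iff_integrable_of_support_subset (s := {x | σ x ≤ 0}) fun x hx ↦ ?_).1
      (hint _ (hχcont.mul hdivc))
    by_contra hx0
    have hx0' : ¬ σ x ≤ 0 := hx0
    have : χ x = 0 := hχ0 x (by have := not_le.1 hx0'; linarith)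
    exact hx (by simp [this])
  have hindi : Integrable ({x | σ x < 0}.indicator (g.vectorDivergence Y)) μ :=
    ((hint _ hdivc).mono_set hDK).integrable_indicator hDm
  -- Step 1: `|∫ χ div Y - A| ≤ M μ(S k) ≤ η / 2`
  have hstep1 : |(∫ x, χ x * g.vectorDivergence Y x ∂μ) - A| ≤ η / 2 := by
    have hA' : A = ∫ x, {x | σ x < 0}.indicator (g.vectorDivergence Y) x ∂μ :=
      (integral_indicator hDm).symm
    rw [hA', ← integral_sub hχdi hindi]
    have hbound : ∀ x, ‖χ x * g.vectorDivergence Y x - {x | σ x < 0}.indicator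
        (g.vectorDivergence Y) x‖ ≤ (S k).indicator (fun _ ↦ M) x := by
      intro x
      rw [Real.norm_eq_abs]
      by_cases hx0 : σ x < 0
      · rw [indicator_of_mem (show x ∈ {x | σ x < 0} from hx0)]
        by_cases hxk : -(1 / ((k : ℝ) + 1)) < σ x
        · rw [indicator_of_mem (show x ∈ S k from ⟨hxk, hx0⟩)]
          have h1 : χ x * g.vectorDivergence Y x - g.vectorDivergence Y x =
              (χ x - 1) * g.vectorDivergence Y x := by ring
          rw [h1, abs_mul]
          have h2 : |χ x - 1| ≤ 1 := by
            rw [abs_le]; constructor <;> linarith [(hχ01 x).1, (hχ01 x).2]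
          calc |χ x - 1| * |g.vectorDivergence Y x| ≤ 1 * |g.vectorDivergence Y x| :=
                mul_le_mul_of_nonneg_right h2 (abs_nonneg _)
            _ ≤ M := by rw [one_mul]; exact hM x hx0.le
        · have hle : σ x ≤ -(2 * ε) := by
            have := not_lt.1 hxk
            linarith
          rw [hχ1 x hle, one_mul, sub_self, abs_zero]
          exact indicator_nonneg (fun _ _ ↦ hM0) _
      · rw [indicator_of_notMem (show x ∉ {x | σ x < 0} from hx0),
          hχ0 x (by have := not_lt.1 hx0; linarith), zero_mul, sub_zero, abs_zero]
        exact indicator_nonneg (fun _ _ ↦ hM0) _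
    have hSfin : μ (S k) < ⊤ := lt_of_le_of_lt (measure_mono (hSK k)) hKfin
    have hbi : Integrable ((S k).indicator fun _ ↦ M) μ :=
      (integrableOn_const (hs := hSfin.ne)).integrable_indicator (hSm k)
    calc |(∫ x, χ x * g.vectorDivergence Y x - {x | σ x < 0}.indicator
            (g.vectorDivergence Y) x ∂μ)|
        ≤ ∫ x, (S k).indicator (fun _ ↦ M) x ∂μ := by
          have := norm_integral_le_of_norm_le hbi (Eventually.of_forall hbound)
          rwa [Real.norm_eq_abs] at this
      _ = (μ (S k)).toReal * M := by
          rw [integral_indicator_const M (hSm k), smul_eq_mul]; rfl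
      _ ≤ η / (2 * (M + 1)) * M := mul_le_mul_of_nonneg_right hk' hM0
      _ ≤ η / 2 := by
          rw [div_mul_eq_mul_div, div_le_iff₀ (by positivity)]
          nlinarith
  -- Step 2: `|∫ χ div Y| = |∫ ψ'(σ) dσ(Y)| ≤ η' C₁ / n₀ ≤ η / 2`
  have hstep2 : |∫ x, χ x * g.vectorDivergence Y x ∂μ| ≤ η / 2 := by
    rw [integral_cutoff_mul_vectorDivergence_eq g hg hσ hK hε hY, abs_neg]
    have hpt : ∀ x, ‖ψ' (σ x) * F x‖ ≤ η' / n₀ * (-ψ' (σ x) * g.gradSq σ x) := by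
      intro x
      rw [Real.norm_eq_abs]
      by_cases h0 : ψ' (σ x) = 0
      · rw [h0]; simp
      · obtain ⟨hx1, hx2⟩ := hψ'supp x h0
        have hσ0 : σ x ≤ 0 := by linarith
        have hFx : |F x| < η' := hcol₂ x (by linarith) hσ0
        have hgx : n₀ < g.gradSq σ x := hcol₁ x (by linarith) hσ0
        have hneg : 0 ≤ -ψ' (σ x) := by linarith [hψ'0 x]
        rw [abs_mul, abs_of_nonpos (hψ'0 x)]
        have h3 : η' ≤ η' / n₀ * g.gradSq σ x := by
          rw [div_mul_eq_mul_div, le_div_iff₀ hn₀]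
          exact mul_le_mul_of_nonneg_left hgx.le hη'0.le
        calc -ψ' (σ x) * |F x| ≤ -ψ' (σ x) * η' := mul_le_mul_of_nonneg_left hFx.le hneg
          _ ≤ -ψ' (σ x) * (η' / n₀ * g.gradSq σ x) := mul_le_mul_of_nonneg_left h3 hneg
          _ = η' / n₀ * (-ψ' (σ x) * g.gradSq σ x) := by ring
    have hψ'σc : HasCompactSupport fun x ↦ ψ' (σ x) := by
      refine HasCompactSupport.of_support_subset_isCompact hK fun x hx ↦ ?_
      by_contra hx0
      have hx0' : ¬ σ x ≤ 0 := hx0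
      exact hx (deriv_smoothTransition_collar_eq_zero hε (Or.inr (by
        have := not_le.1 hx0'; linarith)))
    have hi2 : Integrable (fun x ↦ η' / n₀ * (-ψ' (σ x) * g.gradSq σ x)) μ :=
      ((((hψ'c.comp hσc).neg.mul hgradc).integrable_of_hasCompactSupport
        (hψ'σc.neg.mul_right)).const_mul _)
    calc |∫ x, ψ' (σ x) * F x ∂μ| ≤ ∫ x, η' / n₀ * (-ψ' (σ x) * g.gradSq σ x) ∂μ := by
          have := norm_integral_le_of_norm_le hi2 (Eventually.of_forall hpt)
          rwa [Real.norm_eq_abs] at this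
      _ = η' / n₀ * ∫ x, -ψ' (σ x) * g.gradSq σ x ∂μ := integral_const_mul _ _
      _ ≤ η' / n₀ * C₁ :=
          mul_le_mul_of_nonneg_left (integral_neg_deriv_cutoff_mul_gradSq_le g hg hσ hK hε)
            (by positivity)
      _ ≤ η / 2 := by
          rw [hη']
          have hc : 0 ≤ C₁ / n₀ := by positivity
          rw [show η / (2 * (C₁ / n₀ + 1)) / n₀ * C₁ = η / 2 * ((C₁ / n₀) / (C₁ / n₀ + 1)) by
            field_simp]
          have : (C₁ / n₀) / (C₁ / n₀ + 1) ≤ 1 := by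
            rw [div_le_one (by positivity)]; linarith
          nlinarith
  -- conclusion
  calc |A| = |(A - ∫ x, χ x * g.vectorDivergence Y x ∂μ) + ∫ x, χ x * g.vectorDivergence Y x ∂μ| :=
        by rw [sub_add_cancel]
    _ ≤ |A - ∫ x, χ x * g.vectorDivergence Y x ∂μ| + |∫ x, χ x * g.vectorDivergence Y x ∂μ| :=
        abs_add_le _ _
    _ ≤ η / 2 + η / 2 := add_le_add (by rwa [abs_sub_comm]) hstep2
    _ = η := by ring

omit [I.Boundaryless] [T2Space N] [LocallyCompactSpace N] [SigmaCompactSpace N]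
  [MeasurableSpace N] [BorelSpace N] in
/-- `div (Y - Z) = div Y - div Z` for `C¹` fields. [folklore] -/
theorem vectorDivergence_sub {Y Z : Π x : N, TangentSpace I x} (hY : CMDiff 1 (T% Y))
    (hZ : CMDiff 1 (T% Z)) (x : N) :
    g.vectorDivergence (Y - Z) x = g.vectorDivergence Y x - g.vectorDivergence Z x := by
  set c : N → ℝ := fun _ ↦ (-1 : ℝ) with hc_def
  have hcs : CMDiff 1 c := contMDiff_const
  have hcZ : CMDiff 1 (T% (c • Z)) := hcs.smul_section hZ
  have heq : (Y - Z : Π x : N, TangentSpace I x) = Y + c • Z := by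
    funext y
    simp [hc_def, sub_eq_add_neg]
  rw [heq, vectorDivergence_add ((hY x).mdifferentiableAt one_ne_zero)
    ((hcZ x).mdifferentiableAt one_ne_zero),
    vectorDivergence_smul ((hZ x).mdifferentiableAt one_ne_zero)
      ((hcs x).mdifferentiableAt one_ne_zero)]
  have h0 : mvfderiv I c x = 0 := mvfderiv_const (-1 : ℝ)
  rw [h0]
  simp [hc_def]
  ring

/-- **The flux through `∂D` depends only on the normal component on the boundary**: for `C¹`
fields `Y, Z` with `dσ(Y) = dσ(Z)` on `{σ = 0}` (regular sublevel domain as above),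
`∫_{σ<0} div Y dμ_g = ∫_{σ<0} div Z dμ_g` (`setIntegral_vectorDivergence_sublevel_eq_zero` for
`Y - Z`). [cite: Lee2018, Thm. 2.28] -/
theorem setIntegral_vectorDivergence_sublevel_congr (hg : g.IsRiemannian) {σ : N → ℝ}
    (hσ : CMDiff ∞ σ) (hK : IsCompact {x | σ x ≤ 0}) (hreg : ∀ x, σ x = 0 → 0 < g.gradSq σ x)
    {Y Z : Π x : N, TangentSpace I x} (hY : CMDiff 1 (T% Y)) (hZ : CMDiff 1 (T% Z))
    (hYZ : ∀ x, σ x = 0 → mvfderiv I σ x (Y x) = mvfderiv I σ x (Z x)) :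
    ∫ x in {x | σ x < 0}, g.vectorDivergence Y x
        ∂(riemannianMeasure (g.toContMDiffRiemannianMetric hg)) =
      ∫ x in {x | σ x < 0}, g.vectorDivergence Z x
        ∂(riemannianMeasure (g.toContMDiffRiemannianMetric hg)) := by
  set μ : Measure N := riemannianMeasure (g.toContMDiffRiemannianMetric hg) with hμ
  haveI : IsFiniteMeasureOnCompacts μ :=
    ⟨fun K hK ↦ riemannianVolume_lt_top_of_isCompact_holds _ le_rfl hK⟩
  have h0 := setIntegral_vectorDivergence_sublevel_eq_zero g hg hσ hK hreg (hY.sub_section hZ)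
    (fun x hx ↦ by
      show mvfderiv I σ x (Y x - Z x) = 0
      rw [map_sub, hYZ x hx, sub_self])
  have hsub : ∀ x, g.vectorDivergence (Y - Z) x =
      g.vectorDivergence Y x - g.vectorDivergence Z x := vectorDivergence_sub g hY hZ
  simp_rw [hsub] at h0
  have hiY : IntegrableOn (g.vectorDivergence Y) {x | σ x < 0} μ :=
    ((continuous_vectorDivergence_of_isRiemannian g hg hY).continuousOn.integrableOn_compact
      hK).mono_set
      fun x (hx : σ x < 0) ↦ hx.le
  have hiZ : IntegrableOn (g.vectorDivergence Z) {x | σ x < 0} μ :=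
    ((continuous_vectorDivergence_of_isRiemannian g hg hZ).continuousOn.integrableOn_compact
      hK).mono_set
      fun x (hx : σ x < 0) ↦ hx.le
  rw [integral_sub hiY hiZ] at h0
  linarith

end Riemannian

end Literature.Geometry.Riemannian
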